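import Summits.NavierStokesRegularity.NavierStokesRegularity.Theses.FilamentSkeletonRss
import Literature.Analysis.FluidPDE.GaussianVortexPlanarProofs

/-!
# `CoreLinearInvertibility` (stmt-NavierStokesRegularity-17973): the zero-mass constraint is load-bearing

Negative-side support for crux `CoreLinearInvertibility` of route `FilamentSkeletonRss`
(cdisprove seat, cycle 1, 2026-08-17).  The crux asks, for every asymmetry `λ ∈ [0,1)`, for
constants `R₀, c > 0` such that the linearised planar core operator at the Gaussian,
`T_{λ,R} w = L_λ w − R (v^G·∇w + (K_{2D}∗w)·∇G)`, obeys `c² ∫ G_λ⁻¹ w² ≤ ∫ G_λ⁻¹ (T_{λ,R} w)²`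
for all `R ≥ R₀` and all admissible `w` with ZERO MASS and zero first moments.

Kernel-checked facts for provers and planners:

* `coreOperator_gaussian_eq_zero` — at `λ = 0` the Gaussian `G` itself is annihilated by
  `T_{0,R}` for EVERY circulation `R` (`L G = 0`, `v^G·∇G = 0`, `(K∗G)·∇G = 0`: Gallay–Wayne
  2005/2007); it has zero first moments (`integral_coord_mul_gaussian`) and weighted norm
  `∫ G⁻¹G² = ∫ G = 1`.
* `coreLinearInvertibility_false_without_massZero` — hence the crux with the single hypothesis
  `∫ w = 0` deleted (everything else verbatim) is FALSE: any proof of `CoreLinearInvertibility`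
  must use the mass constraint (it is what removes the `R`-independent kernel direction `G` of
  `T_{0,R}`; for `λ > 0` the kernel of `T_{λ,R}` on the full space is still one-dimensional with
  nonzero mass whenever the constrained operator is invertible, by the index-zero bookkeeping
  `T_{λ,R}ᵀ 1 = 0`, `T_{λ,R}ᵀ xᵢ = −aᵢ xᵢ`).
* `not_coreLinearInvertibility_imp` — bookkeeping: the deleted-hypothesis statement implies the
  crux, so its failure says nothing against the crux itself (recorded as the contrapositive, whose
  conclusion is negative).
-/

set_option linter.dupNamespace false

namespace Summit.NavierStokesRegularity.NavierStokesRegularity.Theorems.CoreLinearInvertibility.Negative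

open Summit.NavierStokesRegularity.NavierStokesRegularity.Theses.FilamentSkeletonRss
open Literature.Analysis.FluidPDE MeasureTheory
open scoped InnerProductSpace RealInnerProductSpace

/-- `v^G · ∇G = 0` pointwise: the Gaussian's velocity is azimuthal, its gradient radial. [folklore] -/
theorem inner_gaussVortexVelocity_gradient_gaussian (x : (EuclideanSpace ℝ (Fin 2))) :
    ⟪gaussVortexVelocity x, gradient gaussVortexProfile x⟫ = 0 := by
  rw [real_inner_comm, gradient, InnerProductSpace.toDual_symm_apply,
    fderiv_gaussVortexProfile_apply, gaussVortexVelocity, inner_smul_right, inner_self_perp]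
  ring

/-- `(K ∗ G) · ∇G = 0` pointwise (Gallay–Wayne: `K ∗ G = v^G` is azimuthal). [folklore] -/
theorem inner_biotSavart2D_gaussian_gradient_gaussian (x : (EuclideanSpace ℝ (Fin 2))) :
    ⟪biotSavart2D gaussVortexProfile x, gradient gaussVortexProfile x⟫ = 0 := by
  have h1 : (fun y : (EuclideanSpace ℝ (Fin 2)) => (1 : ℝ) * gaussVortexProfile y) = gaussVortexProfile := by
    funext y; exact one_mul _
  have := inner_biotSavart2D_gradient_gaussian 1 x
  rwa [h1] at this

/-- **`T_{0,R} G = 0` for every `R`**: at `λ = 0` the Gaussian is annihilated by the linearised core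
operator `L₀ − RΛ_G`, whatever the circulation. [folklore] -/
theorem coreOperator_gaussian_eq_zero (R : ℝ) (x : (EuclideanSpace ℝ (Fin 2))) :
    strainedVorticityOperator 0 gaussVortexProfile x -
        R * (⟪gaussVortexVelocity x, gradient gaussVortexProfile x⟫ +
          ⟪biotSavart2D gaussVortexProfile x, gradient gaussVortexProfile x⟫) = 0 := by
  have h1 : (fun y : (EuclideanSpace ℝ (Fin 2)) => (1 : ℝ) * gaussVortexProfile y) = gaussVortexProfile := by
    funext y; exact one_mul _
  have hL := strainedVorticityOperator_zero_gaussian 1 x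
  rw [h1] at hL
  rw [hL, inner_gaussVortexVelocity_gradient_gaussian, inner_biotSavart2D_gaussian_gradient_gaussian]
  ring

/-- The Biot–Savart integral of `G` converges absolutely at every point. [folklore] -/
theorem integrable_gaussVortexProfile_smul_biotSavartKernel2D (x : (EuclideanSpace ℝ (Fin 2))) :
    Integrable (fun y => gaussVortexProfile y • biotSavartKernel2D (x - y)) := by
  have h1 : (fun y : (EuclideanSpace ℝ (Fin 2)) => ((1 : ℝ) * gaussVortexProfile y) • biotSavartKernel2D (x - y)) =
      fun y => gaussVortexProfile y • biotSavartKernel2D (x - y) := by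
    funext y; rw [one_mul]
  rw [← h1]
  exact integrable_gaussian_smul_biotSavartKernel2D 1 x

/-- `G⁻¹ G² = G` pointwise (`G > 0`). [folklore] -/
theorem inv_gaussian_mul_sq (x : (EuclideanSpace ℝ (Fin 2))) :
    (gaussVortexProfile x)⁻¹ * gaussVortexProfile x ^ 2 = gaussVortexProfile x := by
  have h := (gaussVortexProfile_pos x).ne'
  field_simp

/-- The first moments of the (even) Gaussian vanish: `∫ xᵢ G(x) dx = 0`. [folklore] -/
theorem integral_coord_mul_gaussian (i : Fin 2) :
    ∫ x : (EuclideanSpace ℝ (Fin 2)), x i * gaussVortexProfile x = 0 := by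
  set S : (EuclideanSpace ℝ (Fin 2)) ≃ₗᵢ[ℝ] (EuclideanSpace ℝ (Fin 2)) := LinearIsometryEquiv.neg ℝ with hS
  have hodd : ∀ x : (EuclideanSpace ℝ (Fin 2)), (S x) i * gaussVortexProfile (S x) = -(x i * gaussVortexProfile x) := by
    intro x
    have hn : gaussVortexProfile (S x) = gaussVortexProfile x := by
      simp [hS, gaussVortexProfile, norm_neg]
    rw [hn]
    simp [hS]
  have hI : ∫ x : (EuclideanSpace ℝ (Fin 2)), (S x) i * gaussVortexProfile (S x) = ∫ x : (EuclideanSpace ℝ (Fin 2)), x i * gaussVortexProfile x :=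
    MeasureTheory.integral_comp S (fun x : (EuclideanSpace ℝ (Fin 2)) => x i * gaussVortexProfile x)
  simp_rw [hodd, integral_neg] at hI
  linarith

/-- **The zero-mass constraint is load-bearing.**  `CoreLinearInvertibility` with the hypothesis
`∫ x, w x = 0` deleted and everything else kept verbatim is FALSE: at `λ = 0` the Gaussian `G`
satisfies every remaining hypothesis for every `R` (it is `C²`, `∫ G⁻¹G² = 1 < ∞`, its Biot–Savart
integrals converge, `T_{0,R}G = 0` so the image norm is `0`, and its first moments vanish), while the
conclusion would read `c² · 1 ≤ 0`. [folklore] -/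
theorem coreLinearInvertibility_false_without_massZero :
    ¬ (∀ lam ∈ Set.Ico (0 : ℝ) 1, ∃ R₀ c : ℝ, 0 < c ∧ ∀ R : ℝ, R₀ ≤ R →
        ∀ w : EuclideanSpace ℝ (Fin 2) → ℝ, ContDiff ℝ 2 w →
        Integrable (fun x => (gaussWeightLam lam x)⁻¹ * w x ^ 2) →
        (∀ x, Integrable (fun y => w y • biotSavartKernel2D (x - y))) →
        Integrable (fun x => (gaussWeightLam lam x)⁻¹ *
          (strainedVorticityOperator lam w x - R * (⟪gaussVortexVelocity x, gradient w x⟫_ℝ +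
            ⟪biotSavart2D w x, gradient gaussVortexProfile x⟫_ℝ)) ^ 2) →
        ∫ x, x 0 * w x = 0 → ∫ x, x 1 * w x = 0 →
        c ^ 2 * ∫ x, (gaussWeightLam lam x)⁻¹ * w x ^ 2 ≤
          ∫ x, (gaussWeightLam lam x)⁻¹ *
            (strainedVorticityOperator lam w x - R * (⟪gaussVortexVelocity x, gradient w x⟫_ℝ +
              ⟪biotSavart2D w x, gradient gaussVortexProfile x⟫_ℝ)) ^ 2) := by
  intro h
  obtain ⟨R₀, c, hc, hR⟩ := h 0 ⟨le_rfl, one_pos⟩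
  have key := hR R₀ le_rfl gaussVortexProfile contDiff_gaussVortexProfile ?_
    integrable_gaussVortexProfile_smul_biotSavartKernel2D ?_ (integral_coord_mul_gaussian 0)
    (integral_coord_mul_gaussian 1)
  · simp_rw [coreOperator_gaussian_eq_zero, gaussWeightLam_zero, inv_gaussian_mul_sq,
      integral_gaussVortexProfile] at key
    norm_num at key
    nlinarith [sq_pos_of_pos hc]
  · simp_rw [gaussWeightLam_zero, inv_gaussian_mul_sq]
    exact integrable_gaussVortexProfile
  · simp_rw [coreOperator_gaussian_eq_zero, gaussWeightLam_zero]
    simp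

/-- Bookkeeping (contrapositive form, negative conclusion): the deleted-hypothesis statement is
STRONGER than the crux, so `coreLinearInvertibility_false_without_massZero` is no evidence against
`CoreLinearInvertibility` — it only locates a hypothesis every proof must consume. [folklore] -/
theorem not_coreLinearInvertibility_imp (hneg : ¬ CoreLinearInvertibility) :
    ¬ (∀ lam ∈ Set.Ico (0 : ℝ) 1, ∃ R₀ c : ℝ, 0 < c ∧ ∀ R : ℝ, R₀ ≤ R →
        ∀ w : EuclideanSpace ℝ (Fin 2) → ℝ, ContDiff ℝ 2 w →
        Integrable (fun x => (gaussWeightLam lam x)⁻¹ * w x ^ 2) →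
        (∀ x, Integrable (fun y => w y • biotSavartKernel2D (x - y))) →
        Integrable (fun x => (gaussWeightLam lam x)⁻¹ *
          (strainedVorticityOperator lam w x - R * (⟪gaussVortexVelocity x, gradient w x⟫_ℝ +
            ⟪biotSavart2D w x, gradient gaussVortexProfile x⟫_ℝ)) ^ 2) →
        ∫ x, x 0 * w x = 0 → ∫ x, x 1 * w x = 0 →
        c ^ 2 * ∫ x, (gaussWeightLam lam x)⁻¹ * w x ^ 2 ≤
          ∫ x, (gaussWeightLam lam x)⁻¹ *
            (strainedVorticityOperator lam w x - R * (⟪gaussVortexVelocity x, gradient w x⟫_ℝ +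
              ⟪biotSavart2D w x, gradient gaussVortexProfile x⟫_ℝ)) ^ 2) := by
  intro h
  refine hneg fun lam hlam => ?_
  obtain ⟨R₀, c, hc, H⟩ := h lam hlam
  exact ⟨R₀, c, hc, fun R hR w h1 h2 h3 h4 _ h6 h7 => H R hR w h1 h2 h3 h4 h6 h7⟩

end Summit.NavierStokesRegularity.NavierStokesRegularity.Theorems.CoreLinearInvertibility.Negative
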